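import Mathlib
import Summits.ABC.Statement

/-!
# Kummer transport — the power transport `T_M` and the transport theorem for level-cell doors

Helper kernel for route RootDecompB's crux `KummerFloorCell5` (stmt-ABC-23645) and for the level-cell
doors B / G / E of cell decomp-abc (lens 2 «Kummer discriminant tower», generation 9; critic CLEARED,
decomp-abc STATUS l.528).  This file imports ONLY `Mathlib` and `Summits.ABC.Statement` (no
`Theses.RootDecomp*`), so that a route's `closes` may cite it (a Theorems file cited by a route's glue must be
importable BY the route file).

CONTENT (all [folklore], sorry-free): the POWER TRANSPORT `T_M (a,b,c) = (a^M, c^M − a^M, c^M)`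
(`isABCTriple_powTransport`; `rad_powTransport_le : rad(T_M t) ≤ rad(t) · M c^{M−1}`), and the TRANSPORT
THEOREM for level cells: `ImageFloor(L,s) → Cell(L,s) → ABC` (`abc_of_imageFloorOn_of_cell`),
`TowerFloor(L,s) → Cell(L,s) → ABC` (`abc_of_towerFloorOn_of_cell`); instantiated on the Kummer levels:
`closesB_tower : TowerKummerFloor5T → KummerFloorCell5T → ABC`, `closesB_high : KummerFloorHighT →
KummerFloorCell5T → ABC`, `closesG_tower : TowerKummerFloor4T → KummerFloorCell4T → ABC`, where the `…T`
Props are the item texts of route B (23644 `KummerFloor5`, 23645 `KummerFloorCell5`, 25300 `KummerFloorHigh`)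
and route G (27123 `KummerFloor4`, 27124 `KummerFloorCell4`) re-declared VERBATIM (they are the route decls
definitionally), plus the tower / image floors `TowerKummerFloor5T`, `ImageKummerFloor5T`, `TowerKummerFloor4T`.

HONESTY.  This file proves NO route item and does not prove `ABC`: every door here is an implication whose
floor hypothesis (`KummerFloor5`, `TowerKummerFloor5T`, …) is an OPEN, summit-adjacent statement that stays
DECLARED, never discharged.  What it records is the folklore fact that the floor half of a level-cell door is
needed on ONE power image / on the high-exponent triples only, because `T_M` costs a factor `M c^{M−1}` in the
radical with `M` FIXED — harmless as `ε → 0`.  Source: decomp-abc lens-2 g9 `pkg/KummerTransport.lean`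
(sha16 19192d0fb06156ab) with mechanical edits only (namespace, docstrings, four one-line API lemmas inlined).
-/

set_option linter.dupNamespace false

noncomputable section

open Finset
open Literature.NumberTheory.DiophantineGeometry (IsABCTriple rad rad_def)

namespace Summit.ABC.ABC.Theorems.KummerTransport

/-! ## Vocabulary -/

/-- The `ℓ`-free radical `N_ℓ(n) := ∏_{q ∣ n, ℓ ∤ v_q(n)} q`. [folklore] -/
def freeRad (ℓ n : ℕ) : ℕ :=
  ∏ q ∈ n.primeFactors.filter (fun q => ¬ ℓ ∣ n.factorization q), q

/-- The top exponent `e(n) := max_q v_q(n)`. [folklore] -/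
def topExp (n : ℕ) : ℕ :=
  n.primeFactors.sup fun q => n.factorization q

/-- The Kummer level `N_ℓ(abc)` as a level function. [folklore] -/
def levelN (ℓ : ℕ) : ℕ → ℕ → ℕ → ℕ := fun a b c => freeRad ℓ (a * b * c)

section LevelCells

variable (L : ℕ → ℕ → ℕ → ℕ) (s : ℕ)

/-- `Cell(L,s)`: abc(1+ε) on every cell `c ≤ K·L^s`. -/
def CellABC : Prop :=
  ∀ K : ℕ, ∀ ε : ℝ, 0 < ε → ∃ C : ℝ, 0 < C ∧ ∀ a b c : ℕ, IsABCTriple a b c →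
    c ≤ K * L a b c ^ s → (c : ℝ) < C * ((rad a b c : ℕ) : ℝ) ^ (1 + ε)

/-- `Floor(L,s)`: `c ≤ C·L^s` for all triples. -/
def FloorOn : Prop :=
  ∃ C : ℕ, ∀ a b c : ℕ, IsABCTriple a b c → c ≤ C * L a b c ^ s

/-- `TowerFloor(L,s)`: `c ≤ C·L^s` on the triples of top exponent `≥ e₀`. -/
def TowerFloorOn : Prop :=
  ∃ C e₀ : ℕ, ∀ a b c : ℕ, IsABCTriple a b c → e₀ ≤ topExp (a * b * c) → c ≤ C * L a b c ^ s

/-- `ImageFloor(L,s)`: for SOME `M ≥ 1`, `C`: `c^M ≤ C·L(T_M t)^s` on the power images of all triples. -/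
def ImageFloorOn : Prop :=
  ∃ M C : ℕ, M ≠ 0 ∧ ∀ a b c : ℕ, IsABCTriple a b c → c ^ M ≤ C * L (a ^ M) (c ^ M - a ^ M) (c ^ M) ^ s

end LevelCells

/-! ## Basic API -/

/-- `q^ℓ ∣ n ≠ 0` with `q` prime gives `ℓ ≤ e(n)`. [folklore] -/
theorem le_topExp_of_pow_dvd {ℓ n q : ℕ} (hℓ : 0 < ℓ) (hn : n ≠ 0) (hq : q.Prime) (hdvd : q ^ ℓ ∣ n) :
    ℓ ≤ topExp n := by
  rw [topExp, Finset.le_sup_iff (bot_le.trans_lt hℓ)]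
  exact ⟨q, Nat.mem_primeFactors.mpr ⟨hq, (dvd_pow_self q hℓ.ne').trans hdvd, hn⟩,
    (hq.pow_dvd_iff_le_factorization hn).1 hdvd⟩

/-- A floor is in particular a tower floor (`e₀ := 0`). [folklore] -/
theorem towerFloorOn_of_floorOn {L : ℕ → ℕ → ℕ → ℕ} {s : ℕ} (h : FloorOn L s) : TowerFloorOn L s := by
  obtain ⟨C, h⟩ := h
  exact ⟨C, 0, fun a b c ht _ => h a b c ht⟩

/-! ## The power transport and the transport theorem -/

section Transport

variable {L : ℕ → ℕ → ℕ → ℕ} {s : ℕ}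

/-- The power transport `T_M : (a, b, c) ↦ (a^M, c^M − a^M, c^M)` preserves abc triples. [folklore] -/
theorem isABCTriple_powTransport {a b c M : ℕ} (ht : IsABCTriple a b c) (hM : M ≠ 0) :
    IsABCTriple (a ^ M) (c ^ M - a ^ M) (c ^ M) := by
  obtain ⟨ha, hb, habc, hcop⟩ := ht
  have hac : a < c := by omega
  have hpow : a ^ M < c ^ M := Nat.pow_lt_pow_left hac hM
  have hca : Nat.Coprime a c := by
    rw [← habc]; exact Nat.coprime_self_add_right.2 hcop
  refine ⟨Nat.pow_pos ha, Nat.sub_pos_of_lt hpow, Nat.add_sub_of_le hpow.le, ?_⟩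
  exact (Nat.coprime_sub_self_right hpow.le).2 (Nat.Coprime.pow M M hca)

/-- The image is `M`-nontrivial, hence high: `M ≤ e(T_M t)`. [folklore] -/
theorem le_topExp_powTransport {a b c M : ℕ} (ht : IsABCTriple a b c) (hM : M ≠ 0) :
    M ≤ topExp (a ^ M * (c ^ M - a ^ M) * c ^ M) := by
  have hn0 : a ^ M * (c ^ M - a ^ M) * c ^ M ≠ 0 := by
    obtain ⟨ha', hb', habc', -⟩ := isABCTriple_powTransport ht hM
    exact (Nat.mul_pos (Nat.mul_pos ha' hb') (by omega)).ne'
  have hc2 : 2 ≤ c := by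
    obtain ⟨ha, hb, habc, -⟩ := ht
    omega
  obtain ⟨q, hq, hqc⟩ := Nat.exists_prime_and_dvd (show c ≠ 1 by omega)
  exact le_topExp_of_pow_dvd (Nat.pos_of_ne_zero hM) hn0 hq ((pow_dvd_pow_of_dvd hqc M).mul_left _)

/-- **Radical of the image**: `rad(T_M t) ≤ rad(t) · M c^{M−1}` (`c^M − a^M = b · Σ_{i<M} c^i a^{M−1−i}`,
`rad` sub-multiplicative, `rad(x^M) = rad x`). [folklore] -/
theorem rad_powTransport_le {a b c M : ℕ} (ht : IsABCTriple a b c) (hM : M ≠ 0) :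
    rad (a ^ M) (c ^ M - a ^ M) (c ^ M) ≤ rad a b c * (M * c ^ (M - 1)) := by
  obtain ⟨ha, hb, habc, hcop⟩ := id ht
  have hac : a ≤ c := by omega
  set S : ℕ := ∑ i ∈ Finset.range M, c ^ i * a ^ (M - 1 - i) with hSdef
  have hS : S * b = c ^ M - a ^ M := by
    have h := geom_sum₂_mul_of_ge hac M
    rwa [show c - a = b by omega] at h
  have hSle : S ≤ M * c ^ (M - 1) := by
    calc S ≤ ∑ i ∈ Finset.range M, c ^ (M - 1) := by
          refine Finset.sum_le_sum fun i hi => ?_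
          have hi' : i < M := Finset.mem_range.1 hi
          calc c ^ i * a ^ (M - 1 - i) ≤ c ^ i * c ^ (M - 1 - i) :=
                Nat.mul_le_mul_left _ (Nat.pow_le_pow_left hac _)
            _ = c ^ (M - 1) := by rw [← pow_add]; congr 1; omega
      _ = M * c ^ (M - 1) := by rw [Finset.sum_const, Finset.card_range, smul_eq_mul]
  have hS0 : S ≠ 0 := by
    intro h0
    rw [h0, zero_mul] at hS
    exact (Nat.sub_pos_of_lt (Nat.pow_lt_pow_left (show a < c by omega) hM)).ne' hS.symm
  have hac' : Nat.Coprime a c := by rw [← habc]; exact Nat.coprime_self_add_right.mpr hcop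
  have hbc' : Nat.Coprime b c := by rw [← habc]; exact Nat.coprime_add_self_right.mpr hcop.symm
  have h1 : IsRelPrime (a * b) c := Nat.coprime_iff_isRelPrime.mp (Nat.Coprime.mul_left hac' hbc')
  have h2 : IsRelPrime a b := Nat.coprime_iff_isRelPrime.mp hcop
  have hrad : rad a b c = UniqueFactorizationMonoid.radical a * UniqueFactorizationMonoid.radical b *
      UniqueFactorizationMonoid.radical c := by
    rw [rad_def, UniqueFactorizationMonoid.radical_mul h1, UniqueFactorizationMonoid.radical_mul h2]
  have hr0 : rad a b c ≠ 0 := by rw [rad_def]; exact UniqueFactorizationMonoid.radical_ne_zero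
  have hdvd : rad (a ^ M) (c ^ M - a ^ M) (c ^ M) ∣ rad a b c * S := by
    rw [rad_def, hrad, ← hS]
    calc UniqueFactorizationMonoid.radical (a ^ M * (S * b) * c ^ M)
        ∣ UniqueFactorizationMonoid.radical (a ^ M * (S * b)) *
            UniqueFactorizationMonoid.radical (c ^ M) := UniqueFactorizationMonoid.radical_mul_dvd
      _ ∣ (UniqueFactorizationMonoid.radical (a ^ M) * UniqueFactorizationMonoid.radical (S * b)) *
            UniqueFactorizationMonoid.radical (c ^ M) :=
          mul_dvd_mul_right UniqueFactorizationMonoid.radical_mul_dvd _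
      _ ∣ (UniqueFactorizationMonoid.radical (a ^ M) *
            (UniqueFactorizationMonoid.radical S * UniqueFactorizationMonoid.radical b)) *
            UniqueFactorizationMonoid.radical (c ^ M) :=
          mul_dvd_mul_right (mul_dvd_mul_left _ UniqueFactorizationMonoid.radical_mul_dvd) _
      _ ∣ (UniqueFactorizationMonoid.radical a * (S * UniqueFactorizationMonoid.radical b)) *
            UniqueFactorizationMonoid.radical c := by
          rw [UniqueFactorizationMonoid.radical_pow a hM, UniqueFactorizationMonoid.radical_pow c hM]
          exact mul_dvd_mul_right (mul_dvd_mul_left _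
            (mul_dvd_mul_right UniqueFactorizationMonoid.radical_dvd_self _)) _
      _ = UniqueFactorizationMonoid.radical a * UniqueFactorizationMonoid.radical b *
            UniqueFactorizationMonoid.radical c * S := by ring
  calc rad (a ^ M) (c ^ M - a ^ M) (c ^ M) ≤ rad a b c * S :=
        Nat.le_of_dvd (Nat.pos_of_ne_zero (mul_ne_zero hr0 hS0)) hdvd
    _ ≤ rad a b c * (M * c ^ (M - 1)) := Nat.mul_le_mul_left _ hSle

/-- **TRANSPORT THEOREM: `ImageFloor(L,s) → Cell(L,s) → ABC`.** Transport every triple by `T_M`; the image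
lies in the cell `K = C` by the image floor, the cell gives abc(1+ε) there, and the pull-back costs only
`rad(T_M t) ≤ M c^{M−1} rad(t)`: `c^{1−(M−1)ε} < C₁ M^{1+ε} rad^{1+ε}` — harmless as `ε → 0` because `M` is
FIXED (`ε := δ/2M`).  This is exactly what ε-TIED exponent thresholds `e₀(K,ε)` forbid: the floor cofactor of
a cell door transports, an ε-tied high-exponent residual does not. [folklore] -/
theorem abc_of_imageFloorOn_of_cell (hI : ImageFloorOn L s) (hC : CellABC L s) : _root_.ABC := by
  obtain ⟨M, C₀, hM0, hI⟩ := hI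
  have hM1 : 1 ≤ M := Nat.one_le_iff_ne_zero.2 hM0
  have hrad1 : ∀ a b c : ℕ, (1 : ℝ) ≤ ((rad a b c : ℕ) : ℝ) := fun a b c => by
    have h : rad a b c ≠ 0 := by rw [rad_def]; exact UniqueFactorizationMonoid.radical_ne_zero
    exact_mod_cast Nat.one_le_iff_ne_zero.mpr h
  rw [_root_.ABC_iff]
  suffices main : ∀ δ : ℝ, 0 < δ → δ ≤ 1 → ∃ C : ℝ, 0 < C ∧ ∀ a b c : ℕ, IsABCTriple a b c →
      (c : ℝ) < C * ((rad a b c : ℕ) : ℝ) ^ (1 + δ) by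
    intro δ hδ
    obtain ⟨C, hC0, h⟩ := main (min δ 1) (lt_min hδ one_pos) (min_le_right _ _)
    refine ⟨C, hC0, fun a b c ht => (h a b c ht).trans_le ?_⟩
    exact mul_le_mul_of_nonneg_left (Real.rpow_le_rpow_of_exponent_le (hrad1 a b c)
      (by linarith [min_le_left δ 1])) hC0.le
  intro δ hδ hδ1
  have hMR : (1 : ℝ) ≤ (M : ℝ) := by exact_mod_cast hM1
  have hMpos : (0 : ℝ) < (M : ℝ) := lt_of_lt_of_le one_pos hMR
  set ε : ℝ := δ / (2 * M) with hεdef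
  have hε : 0 < ε := by rw [hεdef]; positivity
  set γ : ℝ := 1 - ((M : ℝ) - 1) * ε with hγdef
  have hγhalf : 1 / 2 ≤ γ := by
    have h' : ((M : ℝ) - 1) * ε ≤ 1 / 2 := by
      have h'' : ((M : ℝ) - 1) * ε = (((M : ℝ) - 1) * δ) / (2 * M) := by rw [hεdef]; ring
      rw [h'', div_le_iff₀ (by positivity)]
      nlinarith
    rw [hγdef]; linarith
  have hγ : 0 < γ := by linarith
  obtain ⟨C₁, hC₁, hcell⟩ := hC C₀ ε hε
  set Kc : ℝ := C₁ * (M : ℝ) ^ (1 + ε) with hKdef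
  have hKc : 0 < Kc := by rw [hKdef]; exact mul_pos hC₁ (Real.rpow_pos_of_pos hMpos _)
  refine ⟨Kc ^ (1 / γ), Real.rpow_pos_of_pos hKc _, fun a b c ht => ?_⟩
  -- the transported triple lies in the cell and gets abc(1+ε) there
  have ht' := isABCTriple_powTransport ht hM0
  have hin : c ^ M ≤ C₀ * L (a ^ M) (c ^ M - a ^ M) (c ^ M) ^ s := hI a b c ht
  have h1 : ((c ^ M : ℕ) : ℝ) < C₁ * ((rad (a ^ M) (c ^ M - a ^ M) (c ^ M) : ℕ) : ℝ) ^ (1 + ε) :=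
    hcell _ _ _ ht' hin
  have hradle := rad_powTransport_le ht hM0
  have hc1 : (1 : ℝ) < (c : ℝ) := by
    obtain ⟨ha, hb, habc, -⟩ := ht
    exact_mod_cast (show 2 ≤ c by omega)
  have hc0 : (0 : ℝ) < (c : ℝ) := by linarith
  set R : ℝ := ((rad a b c : ℕ) : ℝ) with hRdef
  have hR1 : 1 ≤ R := hrad1 a b c
  have hR0 : 0 < R := by linarith
  have hrad' : ((rad (a ^ M) (c ^ M - a ^ M) (c ^ M) : ℕ) : ℝ) ≤ R * ((M : ℝ) * (c : ℝ) ^ (M - 1)) := by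
    rw [hRdef]; exact_mod_cast hradle
  have hε1 : 0 < 1 + ε := by linarith
  -- pull-back: c^M < Kc · R^{1+ε} · c^{(M−1)(1+ε)}
  have h2 : (c : ℝ) ^ (M : ℝ) < Kc * R ^ (1 + ε) * (c : ℝ) ^ (((M : ℝ) - 1) * (1 + ε)) := by
    have hcM : ((c ^ M : ℕ) : ℝ) = (c : ℝ) ^ (M : ℝ) := by
      rw [Nat.cast_pow, Real.rpow_natCast]
    have hX0 : (0 : ℝ) ≤ ((rad (a ^ M) (c ^ M - a ^ M) (c ^ M) : ℕ) : ℝ) := Nat.cast_nonneg _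
    have hstep : ((rad (a ^ M) (c ^ M - a ^ M) (c ^ M) : ℕ) : ℝ) ^ (1 + ε) ≤
        (R * ((M : ℝ) * (c : ℝ) ^ (M - 1))) ^ (1 + ε) :=
      Real.rpow_le_rpow hX0 hrad' hε1.le
    have hsplit : (R * ((M : ℝ) * (c : ℝ) ^ (M - 1))) ^ (1 + ε) =
        R ^ (1 + ε) * ((M : ℝ) ^ (1 + ε) * (c : ℝ) ^ (((M : ℝ) - 1) * (1 + ε))) := by
      rw [Real.mul_rpow hR0.le (by positivity), Real.mul_rpow hMpos.le (by positivity)]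
      congr 2
      rw [← Real.rpow_natCast (c : ℝ) (M - 1), ← Real.rpow_mul hc0.le, Nat.cast_sub hM1,
        Nat.cast_one]
    rw [← hcM]
    calc ((c ^ M : ℕ) : ℝ) < C₁ * ((rad (a ^ M) (c ^ M - a ^ M) (c ^ M) : ℕ) : ℝ) ^ (1 + ε) := h1
      _ ≤ C₁ * (R * ((M : ℝ) * (c : ℝ) ^ (M - 1))) ^ (1 + ε) :=
          mul_le_mul_of_nonneg_left hstep hC₁.le
      _ = Kc * R ^ (1 + ε) * (c : ℝ) ^ (((M : ℝ) - 1) * (1 + ε)) := by rw [hsplit, hKdef]; ring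
  -- divide: c^γ < Kc · R^{1+ε}
  have h3 : (c : ℝ) ^ γ < Kc * R ^ (1 + ε) := by
    have hcpow : 0 < (c : ℝ) ^ (((M : ℝ) - 1) * (1 + ε)) := Real.rpow_pos_of_pos hc0 _
    have hγeq : γ = (M : ℝ) - ((M : ℝ) - 1) * (1 + ε) := by rw [hγdef]; ring
    rw [hγeq, Real.rpow_sub hc0, div_lt_iff₀ hcpow]
    exact h2
  -- raise to the power 1/γ
  have h4 : (c : ℝ) < (Kc * R ^ (1 + ε)) ^ (1 / γ) := by
    have hcγ0 : 0 ≤ (c : ℝ) ^ γ := (Real.rpow_pos_of_pos hc0 _).le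
    have h' := Real.rpow_lt_rpow hcγ0 h3 (by positivity : (0 : ℝ) < 1 / γ)
    have hcc : ((c : ℝ) ^ γ) ^ (1 / γ) = (c : ℝ) := by
      rw [← Real.rpow_mul hc0.le, mul_one_div_cancel hγ.ne', Real.rpow_one]
    rwa [hcc] at h'
  have h5 : (Kc * R ^ (1 + ε)) ^ (1 / γ) = Kc ^ (1 / γ) * R ^ ((1 + ε) / γ) := by
    rw [Real.mul_rpow hKc.le (Real.rpow_pos_of_pos hR0 _).le, ← Real.rpow_mul hR0.le]
    congr 2
    ring
  have hexp : (1 + ε) / γ ≤ 1 + δ := by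
    rw [div_le_iff₀ hγ]
    have hid : (1 + δ) * γ - (1 + ε) = δ * ((M : ℝ) - ((M : ℝ) - 1) * δ) / (2 * M) := by
      rw [hγdef, hεdef]; field_simp; ring
    have hnum : 0 ≤ δ * ((M : ℝ) - ((M : ℝ) - 1) * δ) :=
      mul_nonneg hδ.le (by nlinarith [mul_nonneg (sub_nonneg.2 hMR) (sub_nonneg.2 hδ1)])
    have h' : 0 ≤ (1 + δ) * γ - (1 + ε) := by rw [hid]; exact div_nonneg hnum (by positivity)
    linarith
  calc (c : ℝ) < (Kc * R ^ (1 + ε)) ^ (1 / γ) := h4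
    _ = Kc ^ (1 / γ) * R ^ ((1 + ε) / γ) := h5
    _ ≤ Kc ^ (1 / γ) * R ^ (1 + δ) :=
        mul_le_mul_of_nonneg_left (Real.rpow_le_rpow_of_exponent_le hR1 hexp)
          (Real.rpow_pos_of_pos hKc _).le

/-- TowerFloor ⟹ ImageFloor (`M := max e₀ 1`: the image `T_M t` is high). [folklore] -/
theorem imageFloorOn_of_towerFloorOn (h : TowerFloorOn L s) : ImageFloorOn L s := by
  obtain ⟨C, e₀, h⟩ := h
  have hM0 : max e₀ 1 ≠ 0 := (lt_max_of_lt_right Nat.one_pos).ne'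
  exact ⟨max e₀ 1, C, hM0, fun a b c ht => h _ _ _ (isABCTriple_powTransport ht hM0)
    ((le_max_left _ _).trans (le_topExp_powTransport ht hM0))⟩

/-- Floor ⟹ ImageFloor. [folklore] -/
theorem imageFloorOn_of_floorOn (h : FloorOn L s) : ImageFloorOn L s :=
  imageFloorOn_of_towerFloorOn (towerFloorOn_of_floorOn h)

/-- **`TowerFloor(L,s) → Cell(L,s) → ABC`**: the floor piece of EVERY level-cell route (B, G, E) is needed on
the high-exponent triples only. [folklore] -/
theorem abc_of_towerFloorOn_of_cell (hT : TowerFloorOn L s) (hC : CellABC L s) : _root_.ABC :=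
  abc_of_imageFloorOn_of_cell (imageFloorOn_of_towerFloorOn hT) hC

/-- ImageFloor is WEAKER than the summit whenever the tower floor is (`abc → TowerFloor → ImageFloor`);
for a general level we record the relative form. [folklore] -/
theorem imageFloorOn_of_abc_of (hT : _root_.ABC → TowerFloorOn L s) (habc : _root_.ABC) :
    ImageFloorOn L s :=
  imageFloorOn_of_towerFloorOn (hT habc)

end Transport

/-! ## Route B (level `N₅`, exponent 4) and route G (level `N₄`, exponent 5): item texts VERBATIM, doors -/

/-- = `RootDecompB.KummerFloorCell5` (stmt-ABC-23645), verbatim. -/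
def KummerFloorCell5T : Prop :=
  ∀ K : ℕ, ∀ ε : ℝ, 0 < ε → ∃ C : ℝ, 0 < C ∧ ∀ a b c : ℕ, Literature.NumberTheory.DiophantineGeometry.IsABCTriple a b c → c ≤ K * ((a * b * c).primeFactors.filter (fun p => ¬ 5 ∣ (a * b * c).factorization p)).prod (fun p => p) ^ 4 → (c : ℝ) < C * ((Literature.NumberTheory.DiophantineGeometry.rad a b c : ℕ) : ℝ) ^ (1 + ε)

/-- = `RootDecompB.KummerFloor5` (stmt-ABC-23644), verbatim. -/
def KummerFloor5T : Prop :=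
  ∃ C : ℕ, ∀ a b c : ℕ, Literature.NumberTheory.DiophantineGeometry.IsABCTriple a b c → c ≤ C * ((a * b * c).primeFactors.filter (fun p => ¬ 5 ∣ (a * b * c).factorization p)).prod (fun p => p) ^ 4

/-- = `RootDecompB.KummerFloorHigh` (stmt-ABC-25300), verbatim. -/
def KummerFloorHighT : Prop :=
  ∃ C : ℕ, ∀ a b c : ℕ, Literature.NumberTheory.DiophantineGeometry.IsABCTriple a b c → ((∃ x y : ℕ, a = x ^ 5 ∧ b = y ^ 5) ∨ (∃ x z : ℕ, a = x ^ 5 ∧ c = z ^ 5) ∨ (∃ y z : ℕ, b = y ^ 5 ∧ c = z ^ 5)) → c ≤ C * ((a * b * c).primeFactors.filter (fun p => ¬ 5 ∣ (a * b * c).factorization p)).prod (fun p => p) ^ 4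

/-- TKF5 (lens-2 g9): the Kummer floor `c ≤ C·N₅⁴` on the high-exponent triples `e(abc) ≥ e₀`. -/
def TowerKummerFloor5T : Prop :=
  ∃ C e₀ : ℕ, ∀ a b c : ℕ, Literature.NumberTheory.DiophantineGeometry.IsABCTriple a b c → e₀ ≤ ((a * b * c).primeFactors.sup fun p => (a * b * c).factorization p) → c ≤ C * ((a * b * c).primeFactors.filter (fun p => ¬ 5 ∣ (a * b * c).factorization p)).prod (fun p => p) ^ 4

/-- IKF5 (lens-2 g9): the Kummer floor on ONE power image `T_M`. -/
def ImageKummerFloor5T : Prop :=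
  ∃ M C : ℕ, M ≠ 0 ∧ ∀ a b c : ℕ, Literature.NumberTheory.DiophantineGeometry.IsABCTriple a b c → c ^ M ≤ C * (((a ^ M * (c ^ M - a ^ M) * c ^ M).primeFactors.filter (fun p => ¬ 5 ∣ (a ^ M * (c ^ M - a ^ M) * c ^ M).factorization p)).prod (fun p => p)) ^ 4

/-- = `RootDecompG.KummerFloorCell4` (stmt-ABC-27124), verbatim. -/
def KummerFloorCell4T : Prop :=
  ∀ K : ℕ, ∀ ε : ℝ, 0 < ε → ∃ C : ℝ, 0 < C ∧ ∀ a b c : ℕ, Literature.NumberTheory.DiophantineGeometry.IsABCTriple a b c → c ≤ K * ((a * b * c).primeFactors.filter (fun p => ¬ 4 ∣ (a * b * c).factorization p)).prod (fun p => p) ^ 5 → (c : ℝ) < C * ((Literature.NumberTheory.DiophantineGeometry.rad a b c : ℕ) : ℝ) ^ (1 + ε)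

/-- = `RootDecompG.KummerFloor4` (stmt-ABC-27123), verbatim. -/
def KummerFloor4T : Prop :=
  ∃ C : ℕ, ∀ a b c : ℕ, Literature.NumberTheory.DiophantineGeometry.IsABCTriple a b c → c ≤ C * ((a * b * c).primeFactors.filter (fun p => ¬ 4 ∣ (a * b * c).factorization p)).prod (fun p => p) ^ 5

/-- TKF4 (lens-2 g9): the level-`N₄` floor `c ≤ C·N₄⁵` on the high-exponent triples. -/
def TowerKummerFloor4T : Prop :=
  ∃ C e₀ : ℕ, ∀ a b c : ℕ, Literature.NumberTheory.DiophantineGeometry.IsABCTriple a b c → e₀ ≤ ((a * b * c).primeFactors.sup fun p => (a * b * c).factorization p) → c ≤ C * ((a * b * c).primeFactors.filter (fun p => ¬ 4 ∣ (a * b * c).factorization p)).prod (fun p => p) ^ 5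

/-- The item text is the level cell `Cell(N₅,4)`, definitionally. -/
theorem kummerFloorCell5T_iff : KummerFloorCell5T ↔ CellABC (levelN 5) 4 := Iff.rfl
/-- The item text is `Floor(N₅,4)`, definitionally. -/
theorem kummerFloor5T_iff : KummerFloor5T ↔ FloorOn (levelN 5) 4 := Iff.rfl
/-- TKF5 is `TowerFloor(N₅,4)`, definitionally. -/
theorem towerKummerFloor5T_iff : TowerKummerFloor5T ↔ TowerFloorOn (levelN 5) 4 := Iff.rfl
/-- IKF5 is `ImageFloor(N₅,4)`, definitionally. -/
theorem imageKummerFloor5T_iff : ImageKummerFloor5T ↔ ImageFloorOn (levelN 5) 4 := Iff.rfl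
/-- The item text is the level cell `Cell(N₄,5)`, definitionally. -/
theorem kummerFloorCell4T_iff : KummerFloorCell4T ↔ CellABC (levelN 4) 5 := Iff.rfl
/-- The item text is `Floor(N₄,5)`, definitionally. -/
theorem kummerFloor4T_iff : KummerFloor4T ↔ FloorOn (levelN 4) 5 := Iff.rfl
/-- TKF4 is `TowerFloor(N₄,5)`, definitionally. -/
theorem towerKummerFloor4T_iff : TowerKummerFloor4T ↔ TowerFloorOn (levelN 4) 5 := Iff.rfl

/-- `KummerFloorHigh` (25300) ⟹ IKF5 (`M = 5`: the image has two fifth-power coordinates). [folklore] -/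
theorem imageKummerFloor5_of_high (h : KummerFloorHighT) : ImageKummerFloor5T := by
  obtain ⟨C, h⟩ := h
  refine ⟨5, C, by norm_num, fun a b c ht => ?_⟩
  exact h _ _ _ (isABCTriple_powTransport ht (by norm_num)) (Or.inr (Or.inl ⟨a, c, rfl, rfl⟩))

/-- TKF5 ⟹ IKF5. [folklore] -/
theorem imageKummerFloor5_of_tower (h : TowerKummerFloor5T) : ImageKummerFloor5T :=
  imageKummerFloor5T_iff.2 (imageFloorOn_of_towerFloorOn (towerKummerFloor5T_iff.1 h))

/-- `KummerFloor5` (23644) ⟹ IKF5. [folklore] -/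
theorem imageKummerFloor5_of_floor (h : KummerFloor5T) : ImageKummerFloor5T :=
  imageKummerFloor5T_iff.2 (imageFloorOn_of_floorOn (kummerFloor5T_iff.1 h))

/-- `KummerFloor5` (23644) ⟹ TKF5. [folklore] -/
theorem towerKummerFloor5_of_floor (h : KummerFloor5T) : TowerKummerFloor5T :=
  towerKummerFloor5T_iff.2 (towerFloorOn_of_floorOn (kummerFloor5T_iff.1 h))

/-- **Door B on the IMAGE floor: `IKF5 → KummerFloorCell5 → ABC`.** [folklore] -/
theorem closesB_image (hI : ImageKummerFloor5T) (hC : KummerFloorCell5T) : _root_.ABC :=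
  abc_of_imageFloorOn_of_cell (imageKummerFloor5T_iff.1 hI) (kummerFloorCell5T_iff.1 hC)

/-- **Door B on the TOWER floor: `TKF5 → KummerFloorCell5 → ABC`.** [folklore] -/
theorem closesB_tower (hT : TowerKummerFloor5T) (hC : KummerFloorCell5T) : _root_.ABC :=
  closesB_image (imageKummerFloor5_of_tower hT) hC

/-- **Door B on the HIGH floor: `KummerFloorHigh (25300) → KummerFloorCell5 (23645) → ABC`** — the honest-cone
re-close `doorB_without_low` of `PlatonicClosureCoreKummerDoors`, here in a route-importable file. [folklore] -/
theorem closesB_high (hH : KummerFloorHighT) (hC : KummerFloorCell5T) : _root_.ABC :=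
  closesB_image (imageKummerFloor5_of_high hH) hC

/-- Door B as filed: `KummerFloor5 (23644) → KummerFloorCell5 (23645) → ABC`. [folklore] -/
theorem closesB (hF : KummerFloor5T) (hC : KummerFloorCell5T) : _root_.ABC :=
  closesB_image (imageKummerFloor5_of_floor hF) hC

/-- **Door G on the TOWER floor: `TKF4 → KummerFloorCell4 → ABC`.** [folklore] -/
theorem closesG_tower (hT : TowerKummerFloor4T) (hC : KummerFloorCell4T) : _root_.ABC :=
  abc_of_imageFloorOn_of_cell (imageFloorOn_of_towerFloorOn (towerKummerFloor4T_iff.1 hT))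
    (kummerFloorCell4T_iff.1 hC)

/-- Door G as filed: `KummerFloor4 (27123) → KummerFloorCell4 (27124) → ABC`. [folklore] -/
theorem closesG (hF : KummerFloor4T) (hC : KummerFloorCell4T) : _root_.ABC :=
  closesG_tower (towerKummerFloor4T_iff.2 (towerFloorOn_of_floorOn (kummerFloor4T_iff.1 hF))) hC

end Summit.ABC.ABC.Theorems.KummerTransport

end
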